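import Mathlib
import Summits.Ventures.PercRepro2.Defs
import Summits.Ventures.PercRepro2.Independence
import Summits.Ventures.PercRepro2.Harris
import Summits.Ventures.PercRepro2.Graph
import Summits.Ventures.PercRepro2.Exploration
import Summits.Ventures.PercRepro2.Events
import Summits.Ventures.PercRepro2.Induced
import Summits.Ventures.PercRepro2.BHKEvents
import Summits.Ventures.PercRepro2.R4Defs
import Summits.Ventures.PercRepro2.R4Ladder

/-!
# Star-attached roots: connections through a vertex whose neighbours lie in `S`
(blind cell PercRepro2, p1; towards LEAD-PROOFSHAPES §8.7 (9))

If every edge at `o` has its other endpoint in `S` (`StarAttached ends o S`), then with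
`ω' = delConfig ends {o} ω` (the edges at `o` closed) and `hitEdge ends o x = {some open edge o–x}`:

* `conn_to_star`: for `y ≠ o`, `y ↔ o` iff some `x ∈ S` has an open `o–x` edge and `y ↔ x` in `ω'`;
* `conn_star_iff`: for `y, w ≠ o`, `y ↔ w` iff `y ↔ w` in `ω'`, or `y` reaches `o` and `o` reaches `w`
  through `S` as above.
-/

namespace Summit.Ventures.PercRepro2

section StarGraph

variable {V : Type*} {E : Type*}

/-- `{some edge o–x is open}`. -/
def hitEdge (ends : E → Sym2 V) (o x : V) : Set (Config E) :=
  {ω | ∃ e, ω e = true ∧ ends e = s(o, x)}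

/-- Membership in `hitEdge`. -/
@[simp] lemma mem_hitEdge {ends : E → Sym2 V} {o x : V} {ω : Config E} :
    ω ∈ hitEdge ends o x ↔ ∃ e, ω e = true ∧ ends e = s(o, x) := Iff.rfl

variable {ends : E → Sym2 V} {o : V} {S : Finset V}

/-- An edge not touching `o` is open in `delConfig ends {o} ω` iff it is open in `ω`. -/
lemma delConfig_singleton_eq_true_iff {ω : Config E} {e : E} {x y : V} (hends : ends e = s(x, y))
    (hx : x ≠ o) (hy : y ≠ o) : delConfig ends {o} ω e = true ↔ ω e = true := by
  have hnt : e ∉ touches ends ({o} : Set V) := by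
    rintro ⟨z, hz, z', hz'⟩
    rw [Set.mem_singleton_iff] at hz
    subst hz
    rw [hends, Sym2.eq_iff] at hz'
    rcases hz' with ⟨h, _⟩ | ⟨_, h⟩
    · exact hx h
    · exact hy h
  rw [delConfig_apply_of_notMem hnt]

/-- Every edge at `o` is closed in `delConfig ends {o} ω`. -/
lemma delConfig_singleton_eq_false {ω : Config E} {e : E} {x : V} (hends : ends e = s(o, x)) :
    delConfig ends {o} ω e = false :=
  delConfig_apply_of_mem ⟨o, Set.mem_singleton o, x, hends⟩

/-- `delConfig ends {o} ω ≤ ω`. -/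
lemma delConfig_singleton_le (ω : Config E) : delConfig ends {o} ω ≤ ω := by
  intro e
  by_cases h : e ∈ touches ends ({o} : Set V)
  · rw [delConfig_apply_of_mem h]; exact Bool.false_le _
  · rw [delConfig_apply_of_notMem h]

/-- Connections in `ω'` avoid `o`: a vertex reachable from `y ≠ o` in `ω'` is `≠ o`. -/
lemma ne_of_conn_delConfig {ω : Config E} {y w : V} (hy : y ≠ o)
    (h : Conn ends (delConfig ends {o} ω) y w) : w ≠ o := by
  have key : w ∈ {z | z ≠ o} := by
    refine mem_of_conn_of_closed (ends := ends) (ω := delConfig ends {o} ω) ?_ hy h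
    intro x _ z hxz
    obtain ⟨_, e, he, hends⟩ := openGraph_adj.1 hxz
    rintro rfl
    rw [delConfig_singleton_eq_false (by rw [hends, Sym2.eq_swap])] at he
    exact Bool.false_ne_true he
  exact key

/-- **Reaching the star centre**: for `y ≠ o`, `y ↔ o` iff some `x ∈ S` has an open edge `o–x`
and `y ↔ x` in `ω' = delConfig ends {o} ω`. -/
theorem conn_to_star (hS : StarAttached ends o S) {ω : Config E} {y : V} (hy : y ≠ o) :
    Conn ends ω y o ↔ ∃ x ∈ S, ω ∈ hitEdge ends o x ∧ Conn ends (delConfig ends {o} ω) y x := by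
  constructor
  · intro h
    -- the set `M` below contains `y`, is closed under open adjacency, hence contains `o`
    have key : o ∈ {z | (z ≠ o ∧ Conn ends (delConfig ends {o} ω) y z) ∨
        ∃ x ∈ S, ω ∈ hitEdge ends o x ∧ Conn ends (delConfig ends {o} ω) y x} := by
      refine mem_of_conn_of_closed (ends := ends) (ω := ω) ?_ (Or.inl ⟨hy, conn_refl _ _ _⟩) h
      rintro z (⟨hzo, hz⟩ | hz) w hzw
      · obtain ⟨hne, e, he, hends⟩ := openGraph_adj.1 hzw
        by_cases hwo : w = o
        · subst hwo
          have hzS : z ∈ S := by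
            rcases hS e w z (by rw [hends, Sym2.eq_swap]) rfl with h' | h'
            · exact absurd h' hzo
            · exact h'
          exact Or.inr ⟨z, hzS, ⟨e, he, by rw [hends, Sym2.eq_swap]⟩, hz⟩
        · refine Or.inl ⟨hwo, conn_trans hz (conn_of_openAdj ⟨e, ?_, hends⟩)⟩
          exact (delConfig_singleton_eq_true_iff hends hzo hwo).2 he
      · exact Or.inr hz
    rcases key with ⟨hno, _⟩ | h'
    · exact absurd rfl hno
    · exact h'
  · rintro ⟨x, _, ⟨e, he, hends⟩, hc⟩
    exact conn_trans (conn_mono (delConfig_singleton_le ω) hc)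
      (conn_of_openAdj ⟨e, he, by rw [hends, Sym2.eq_swap]⟩)

/-- **Connections through a star-attached `o`** (`o ∉ S`): for `y, w ≠ o`, `y ↔ w` iff `y ↔ w` in
`ω'`, or `y` reaches `o` and `o` reaches `w` (each through an open edge of `o` into `S`). -/
theorem conn_star_iff (hS : StarAttached ends o S) (hoS : o ∉ S) {ω : Config E} {y w : V}
    (hy : y ≠ o) (hw : w ≠ o) :
    Conn ends ω y w ↔ Conn ends (delConfig ends {o} ω) y w ∨
      ((∃ x ∈ S, ω ∈ hitEdge ends o x ∧ Conn ends (delConfig ends {o} ω) y x) ∧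
        ∃ x' ∈ S, ω ∈ hitEdge ends o x' ∧ Conn ends (delConfig ends {o} ω) x' w) := by
  constructor
  · intro h
    have key : w ∈ {z | Conn ends (delConfig ends {o} ω) y z ∨
        ((∃ x ∈ S, ω ∈ hitEdge ends o x ∧ Conn ends (delConfig ends {o} ω) y x) ∧
          (z = o ∨ ∃ x' ∈ S, ω ∈ hitEdge ends o x' ∧ Conn ends (delConfig ends {o} ω) x' z))} := by
      refine mem_of_conn_of_closed (ends := ends) (ω := ω) ?_ (Or.inl (conn_refl _ _ _)) h
      rintro z hz u hzu
      obtain ⟨hne, e, he, hends⟩ := openGraph_adj.1 hzu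
      -- the other endpoint of an open edge from `z ≠ o` is `o` or reachable in `ω'`
      have step : ∀ {x₀ : V}, x₀ ≠ o → Conn ends (delConfig ends {o} ω) x₀ z →
          (u = o ∧ z ∈ S) ∨ (u ≠ o ∧ Conn ends (delConfig ends {o} ω) x₀ u) := by
        intro x₀ hx₀ hc
        have hzo : z ≠ o := ne_of_conn_delConfig hx₀ hc
        by_cases huo : u = o
        · subst huo
          refine Or.inl ⟨rfl, ?_⟩
          rcases hS e u z (by rw [hends, Sym2.eq_swap]) rfl with h' | h'
          · exact absurd h' hzo
          · exact h'
        · exact Or.inr ⟨huo, conn_trans hc (conn_of_openAdj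
            ⟨e, (delConfig_singleton_eq_true_iff hends hzo huo).2 he, hends⟩)⟩
      rcases hz with hz | ⟨hreach, hz⟩
      · rcases step hy hz with ⟨rfl, hzS⟩ | ⟨_, hc⟩
        · exact Or.inr ⟨⟨z, hzS, ⟨e, he, by rw [hends, Sym2.eq_swap]⟩, hz⟩, Or.inl rfl⟩
        · exact Or.inl hc
      · rcases hz with rfl | ⟨x', hx'S, hx', hc⟩
        · -- from `o` along an open edge into `S`
          have huS : u ∈ S := by
            rcases hS e z u hends rfl with h' | h'
            · exact absurd h' hne.symm
            · exact h'
          exact Or.inr ⟨hreach, Or.inr ⟨u, huS, ⟨e, he, hends⟩, conn_refl _ _ _⟩⟩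
        · have hx'o : x' ≠ o := fun h' => hoS (h' ▸ hx'S)
          rcases step hx'o hc with ⟨rfl, _⟩ | ⟨_, hc'⟩
          · exact Or.inr ⟨hreach, Or.inl rfl⟩
          · exact Or.inr ⟨hreach, Or.inr ⟨x', hx'S, hx', hc'⟩⟩
    rcases key with h1 | ⟨hreach, rfl | h2⟩
    · exact Or.inl h1
    · exact absurd rfl hw
    · exact Or.inr ⟨hreach, h2⟩
  · rintro (h | ⟨⟨x, _, ⟨e, he, hends⟩, hc⟩, ⟨x', _, ⟨e', he', hends'⟩, hc'⟩⟩)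
    · exact conn_mono (delConfig_singleton_le ω) h
    · have h1 : Conn ends ω y o := conn_trans (conn_mono (delConfig_singleton_le ω) hc)
        (conn_of_openAdj ⟨e, he, by rw [hends, Sym2.eq_swap]⟩)
      have h2 : Conn ends ω o w := conn_trans (conn_of_openAdj ⟨e', he', hends'⟩)
        (conn_mono (delConfig_singleton_le ω) hc')
      exact conn_trans h1 h2

end StarGraph

end Summit.Ventures.PercRepro2
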